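import Mathlib
import HarnessLib

/-!
# Shell bounds for the covariance tails (Adams–Buchholz–Kotecký–Müller, (7.35), (7.37))

The two momentum regimes of [ABKM19] Lemma 7.3 (`WeightDominatingStep.step_high/step_low`) consume
two estimates on the tail `t' = Σ_{j=k+2}^{N+1} c_j(p)` of the Fourier multipliers of the
finite-range decomposition, both derived from the dyadic SHELL BOUNDS of
`GradientFRD.TorusFRD` (v): for `p` in the shell `j'` (`L^{−j'−1} < |p| ≤ L^{−j'}`),
`c_low L^{2j'} B^{−(j−j')} ≤ c_j(p) ≤ C_up L^{2j'} B^{−(j−j')}` for `j > j'` and `c_j(p) ≥ c_low L^{2j}`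
for `j ≤ j'`, with `B = L^{d−1+n}` (the source's constants absorb the powers `L^{±(2(d+ñ)+1)}`).
This file proves the resulting ABSTRACT real inequalities:

* `tail_sum_le` — (7.35), first half: `Σ_{j=k+2}^{N+1} c_j ≤ 2 C_up L^{2j'} B^{−(k+2−j')}` for
  `j' ≤ k+1`, `B ≥ 2` (geometric series);
* `two_mul_tail_le_inv` — (7.35): `2t' ≤ lam·m⁻¹` once `m ≤ K L^{2(k+1−j')(M−1)} L^{−2j'}` ((7.38) with
  `ρ = L^{−j'}`) and `8 C_up K L^{2(k+1−j')(M−1)} ≤ lam B^{k+2−j'}` (the choice of `k₀`, `n ≥ 2M`);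
* `tail_ge_far`, `tail_ge_near` — (7.37), lower bound `ω₁ |p|^{−2} ≤ t'` in the two cases
  `j' ≥ k+2` (the term `j = j'`) and `k−k₀ ≤ j' < k+2` (the term `j = k+2`), with
  `ω₁ = c_low L^{−2} B^{−(k₀+2)}`.

Everything is proved; no named fact.  The instantiation (reading `C_up, c_low, B` off `TorusFRD` (v)
and the shell of a given `κ`) is left to the caller.

## References
* S. Adams, S. Buchholz, R. Kotecký, S. Müller, arXiv:1910.13564, Lemma 7.3 (7.35), (7.37)
  [AdamsBuchholzKoteckyMuller2019].
-/

noncomputable section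

namespace Literature.MathematicalPhysics.StatisticalMechanics.GradientRG

open Finset

/-! ## (7.35): the tail beyond `k+2` is geometrically small at high momenta -/

/-- **(7.35), geometric series**: if `c_j ≤ C_up·Lsq^{j'}/B^{j−j'}` for `j > j'` (`Lsq = L²`, `B ≥ 2`,
`C_up, Lsq ≥ 0`) and `j' ≤ k+1`, then `Σ_{j=k+2}^{N+1} c_j ≤ 2 C_up Lsq^{j'} / B^{k+2−j'}`.
[cite: AdamsBuchholzKoteckyMuller2019, Lemma 7.3 (7.35)] -/
theorem tail_sum_le {c : ℕ → ℝ} {Cup Lsq B : ℝ} (hB : 2 ≤ B) (hCup : 0 ≤ Cup) (hLsq : 0 ≤ Lsq)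
    {j' k N : ℕ} (hj' : j' ≤ k + 1) (hU : ∀ j, j' < j → c j ≤ Cup * Lsq ^ j' / B ^ (j - j')) :
    ∑ j ∈ Icc (k + 2) (N + 1), c j ≤ 2 * Cup * Lsq ^ j' / B ^ (k + 2 - j') := by
  have hB0 : 0 < B := by linarith
  have hBinv0 : 0 ≤ B⁻¹ := inv_nonneg.2 hB0.le
  have hBinv1 : B⁻¹ < 1 := inv_lt_one_of_one_lt₀ (by linarith)
  have hBinv2 : B⁻¹ ≤ 1 / 2 := by rw [one_div]; exact inv_anti₀ (by norm_num) hB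
  -- termwise: `c_j ≤ Cup Lsq^{j'} B^{j'} (B⁻¹)^j`
  have hterm : ∀ j ∈ Icc (k + 2) (N + 1), c j ≤ Cup * Lsq ^ j' * B ^ j' * (B⁻¹) ^ j := by
    intro j hj
    have hjj' : j' < j := by have := (mem_Icc.1 hj).1; omega
    refine (hU j hjj').trans (le_of_eq ?_)
    rw [div_eq_mul_inv, ← inv_pow, show j = j' + (j - j') from (Nat.add_sub_cancel' hjj'.le).symm,
      pow_add, Nat.add_sub_cancel_left]
    have : B ^ j' * (B⁻¹) ^ j' = 1 := by rw [← mul_pow, mul_inv_cancel₀ hB0.ne', one_pow]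
    calc Cup * Lsq ^ j' * B⁻¹ ^ (j - j')
        = Cup * Lsq ^ j' * (B ^ j' * B⁻¹ ^ j') * B⁻¹ ^ (j - j') := by rw [this, mul_one]
      _ = Cup * Lsq ^ j' * B ^ j' * (B⁻¹ ^ j' * B⁻¹ ^ (j - j')) := by ring
  -- geometric sum over `Ico (k+2) (N+2)`
  have hgeom : ∑ j ∈ Icc (k + 2) (N + 1), (B⁻¹) ^ j ≤ 2 * (B⁻¹) ^ (k + 2) := by
    have hIcc : Icc (k + 2) (N + 1) = Ico (k + 2) (N + 2) := by
      ext j; simp [mem_Icc, mem_Ico]; omega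
    rw [hIcc]
    refine (geom_sum_Ico_le_of_lt_one hBinv0 hBinv1).trans ?_
    rw [div_le_iff₀ (by linarith)]
    nlinarith [pow_nonneg hBinv0 (k + 2)]
  calc ∑ j ∈ Icc (k + 2) (N + 1), c j
      ≤ ∑ j ∈ Icc (k + 2) (N + 1), Cup * Lsq ^ j' * B ^ j' * (B⁻¹) ^ j := sum_le_sum hterm
    _ = Cup * Lsq ^ j' * B ^ j' * ∑ j ∈ Icc (k + 2) (N + 1), (B⁻¹) ^ j := by rw [mul_sum]
    _ ≤ Cup * Lsq ^ j' * B ^ j' * (2 * (B⁻¹) ^ (k + 2)) :=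
        mul_le_mul_of_nonneg_left hgeom (by positivity)
    _ = 2 * Cup * Lsq ^ j' / B ^ (k + 2 - j') := by
        rw [show k + 2 = j' + (k + 2 - j') from (Nat.add_sub_cancel' (by omega)).symm, pow_add,
          Nat.add_sub_cancel_left, inv_pow, inv_pow, div_eq_mul_inv]
        have : B ^ j' * (B ^ j')⁻¹ = 1 := mul_inv_cancel₀ (pow_ne_zero _ hB0.ne')
        calc Cup * Lsq ^ j' * B ^ j' * (2 * ((B ^ j')⁻¹ * (B ^ (k + 2 - j'))⁻¹))
            = 2 * Cup * Lsq ^ j' * (B ^ j' * (B ^ j')⁻¹) * (B ^ (k + 2 - j'))⁻¹ := by ring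
          _ = 2 * Cup * Lsq ^ j' * (B ^ (k + 2 - j'))⁻¹ := by rw [this, mul_one]

/-- **(7.35)**: `2 t' ≤ lam·m⁻¹` from the tail bound, the bound (7.38) on `m = m_{k+1}(p)` at
`|p| ≤ L^{−j'}` (`m ≤ K·G/Lsq^{j'}` with `G = L^{2(k+1−j')(M−1)}`) and the smallness
`4 C_up K G ≤ lam B^{k+2−j'}` (guaranteed by `k+1−j' ≥ k₀(lam)` when `L^{2(M−1)} ≤ B`).
[cite: AdamsBuchholzKoteckyMuller2019, Lemma 7.3 (7.35)] -/
theorem two_mul_tail_le_inv {t' m lam Cup K G Lsq B : ℝ} {j' k : ℕ} (hB : 0 < B) (hLsq : 0 < Lsq)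
    (hm0 : 0 < m) (ht' : t' ≤ 2 * Cup * Lsq ^ j' / B ^ (k + 2 - j'))
    (hm : m ≤ K * G / Lsq ^ j') (hCup : 0 ≤ Cup)
    (hsmall : 4 * Cup * (K * G) ≤ lam * B ^ (k + 2 - j')) : 2 * t' ≤ lam * m⁻¹ := by
  have hLj : 0 < Lsq ^ j' := pow_pos hLsq _
  have hBe : 0 < B ^ (k + 2 - j') := pow_pos hB _
  -- `2 t' m ≤ 4 Cup K G / B^{k+2−j'} ≤ lam`
  rw [← div_eq_mul_inv, le_div_iff₀ hm0]
  have h1 : 2 * t' * m ≤ 2 * (2 * Cup * Lsq ^ j' / B ^ (k + 2 - j')) * (K * G / Lsq ^ j') := by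
    have ht'0 : 2 * t' ≤ 2 * (2 * Cup * Lsq ^ j' / B ^ (k + 2 - j')) := by linarith
    have h2 : 0 ≤ 2 * (2 * Cup * Lsq ^ j' / B ^ (k + 2 - j')) := by positivity
    calc 2 * t' * m ≤ 2 * (2 * Cup * Lsq ^ j' / B ^ (k + 2 - j')) * m :=
          mul_le_mul_of_nonneg_right ht'0 hm0.le
      _ ≤ _ := mul_le_mul_of_nonneg_left hm h2
  have h3 : 2 * (2 * Cup * Lsq ^ j' / B ^ (k + 2 - j')) * (K * G / Lsq ^ j') =
      4 * Cup * (K * G) / B ^ (k + 2 - j') := by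
    field_simp
    ring
  rw [h3] at h1
  have h4 : 4 * Cup * (K * G) / B ^ (k + 2 - j') ≤ lam := by
    rw [div_le_iff₀ hBe]; exact hsmall
  exact h1.trans h4

/-! ## (7.37): the tail is bounded below at low momenta -/

/-- **(7.37), far shells** (`j' ≥ k+2`, the term `j = j'` of the tail): if `c_j ≥ 0`,
`c_{j'} ≥ c_low Lsq^{j'}`, `j' ≤ N+1` and `r⁻¹ ≤ Lsq·Lsq^{j'}` (`r = |p|²`, `|p| > L^{−j'−1}`), then
`c_low/Lsq · r⁻¹ ≤ Σ_{j=k+2}^{N+1} c_j`. [cite: AdamsBuchholzKoteckyMuller2019, Lemma 7.3 (7.37)] -/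
theorem tail_ge_far {c : ℕ → ℝ} {clow Lsq r : ℝ} {j' k N : ℕ} (hc : ∀ j, 0 ≤ c j) (hclow : 0 ≤ clow)
    (hLsq : 0 < Lsq) (hkj' : k + 2 ≤ j') (hj'N : j' ≤ N + 1) (hLo : clow * Lsq ^ j' ≤ c j')
    (hr : r⁻¹ ≤ Lsq * Lsq ^ j') :
    clow / Lsq * r⁻¹ ≤ ∑ j ∈ Icc (k + 2) (N + 1), c j := by
  have hmem : j' ∈ Icc (k + 2) (N + 1) := mem_Icc.2 ⟨hkj', hj'N⟩
  refine le_trans ?_ (single_le_sum (fun j _ => hc j) hmem)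
  refine le_trans ?_ hLo
  calc clow / Lsq * r⁻¹ ≤ clow / Lsq * (Lsq * Lsq ^ j') :=
        mul_le_mul_of_nonneg_left hr (div_nonneg hclow hLsq.le)
    _ = clow * Lsq ^ j' := by field_simp

/-- **(7.37), near shells** (`j' < k+2`, the term `j = k+2` of the tail): if `c_j ≥ 0`,
`c_{k+2} ≥ c_low Lsq^{j'}/B^{k+2−j'}` with `k+2−j' ≤ k₀+2`, `B ≥ 1`, `k+2 ≤ N+1` and
`r⁻¹ ≤ Lsq·Lsq^{j'}`, then `c_low/(Lsq·B^{k₀+2}) · r⁻¹ ≤ Σ_{j=k+2}^{N+1} c_j`.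
[cite: AdamsBuchholzKoteckyMuller2019, Lemma 7.3 (7.37)] -/
theorem tail_ge_near {c : ℕ → ℝ} {clow Lsq B r : ℝ} {j' k k₀ N : ℕ} (hc : ∀ j, 0 ≤ c j)
    (hclow : 0 ≤ clow) (hLsq : 0 < Lsq) (hB : 1 ≤ B) (hkN : k + 2 ≤ N + 1)
    (hk₀ : k + 2 - j' ≤ k₀ + 2) (hLo : clow * Lsq ^ j' / B ^ (k + 2 - j') ≤ c (k + 2))
    (hr : r⁻¹ ≤ Lsq * Lsq ^ j') :
    clow / (Lsq * B ^ (k₀ + 2)) * r⁻¹ ≤ ∑ j ∈ Icc (k + 2) (N + 1), c j := by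
  have hmem : k + 2 ∈ Icc (k + 2) (N + 1) := mem_Icc.2 ⟨le_rfl, hkN⟩
  refine le_trans ?_ (single_le_sum (fun j _ => hc j) hmem)
  refine le_trans ?_ hLo
  have hB0 : 0 < B := by linarith
  have hBpow : B ^ (k + 2 - j') ≤ B ^ (k₀ + 2) := pow_le_pow_right₀ hB hk₀
  have hBe : 0 < B ^ (k + 2 - j') := pow_pos hB0 _
  calc clow / (Lsq * B ^ (k₀ + 2)) * r⁻¹
      ≤ clow / (Lsq * B ^ (k₀ + 2)) * (Lsq * Lsq ^ j') :=
        mul_le_mul_of_nonneg_left hr (by positivity)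
    _ = clow * Lsq ^ j' / B ^ (k₀ + 2) := by field_simp
    _ ≤ clow * Lsq ^ j' / B ^ (k + 2 - j') :=
        div_le_div_of_nonneg_left (by positivity) hBe hBpow

end Literature.MathematicalPhysics.StatisticalMechanics.GradientRG

end
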